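import Summits.ValiantsHypothesis.ValiantsHypothesis.Theorems.BarrierLeverPartitionMinorsHitByVPHiddenStatesBallCutClassification

/-!
# Route BarrierLever — item `PartitionMinorsHitByVP` (stmt-ValiantsHypothesis-19717), line `hidden-states`:
# THE CLASSIFICATION ENGINE, II — the check, its segments, the TRANSFER THEOREM, and the alphabet of unbalanced types

Helper file (`--supports stmt-ValiantsHypothesis-19717`; cell valiant-natproofs, 𝒟-side door (c), registered line
`Cruxes/PartitionMinorsHitByVP/Lines/hidden_states.lean` v10; prover seat val-np-p6 gen 22).  Closes NO item; nothing is certified HERE.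
Companion of `…BallCutClassification` (types, rebuilt families, the complete enumerator `enumSeq`).  Here: `checkEntry` / `checkCnt` /
`checkAll` (+ segments `checkSeg`, `checkAllSeg` and the covering lemmas, for splitting one level into several `native_decide`s),
★ `exists_table_of_checkCnt` (a passed check serves EVERY down-closed 3-swap family of that level and support whose coordinate types lie in
the alphabet — via the count vector, `exists_perm_comp_eq`, and `exists_table_of_certCheckN_map` along the conjugating permutation), and
the alphabet `unbalancedTypes` with `typeCode_mem_unbalancedTypes` (totally unbalanced ⇒ types in the alphabet) and
`le_of_typeCode_mem_unbalancedTypes` (support `≤ Σ|A_l| + Σ|C_l|`).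

HONEST LABEL: classification toolkit; 19717 stays OPEN; nothing on crux 14610 or VP ≠ VNP.
-/

set_option linter.dupNamespace false

namespace Summit.ValiantsHypothesis.ValiantsHypothesis.Theorems.BarrierLever.HiddenStates

open Finset

namespace BallCut

open MoorePeel

/-! ## 5. The check and the transfer theorem -/

/-- **One entry of the classification check**: if the family rebuilt from the type list `L` has the shape of a down-closed 3-swap
family (cards `t`, `t+1`, injective, no `A_l ⊆ C_l'`, exactly `len` coordinates) then the fast certificate passes at one of the `seeds`. -/
def checkEntry (t len : ℕ) (seeds : List ℕ) (p : ℕ) (L : List (Fin 64)) : Bool :=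
  let A := famA (rlFun L)
  let C := famC (rlFun L)
  !(decide (L.length = len) && shapeOK L.length t A C && decide (∀ l l', ¬ A l ⊆ C l')) ||
    seeds.any fun s => certCheckN L.length t A C (stdTable s L.length) p

/-- The incidence budgets of level `t`: `|A_l| = t`, `|C_l| = t + 1`. -/
def budget (t : ℕ) (i : Fin 6) : ℕ := if i.val < 3 then t else t + 1

/-- **The classification check** at level `t` for families with `len` coordinates: every enumerated type list passes `checkEntry`. -/
def checkCnt (alphabet : List (Fin 64)) (t len : ℕ) (seeds : List ℕ) (p : ℕ) : Bool :=
  (enumSeq alphabet (budget t)).all (checkEntry t len seeds p)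

/-- A SEGMENT of the classification check (entries `a, …, a + k - 1` of the enumeration), for splitting one level into several
`native_decide`s. -/
def checkSeg (alphabet : List (Fin 64)) (t len : ℕ) (seeds : List ℕ) (p : ℕ) (a k : ℕ) : Bool :=
  (((enumSeq alphabet (budget t)).drop a).take k).all (checkEntry t len seeds p)

/-- Segments of length `k` starting at `0, k, 2k, …, (m-1)k` that cover the enumeration give the whole check. -/
theorem checkCnt_of_checkSeg (alphabet : List (Fin 64)) (t len : ℕ) (seeds : List ℕ) (p : ℕ) (k m : ℕ)
    (hlen : (enumSeq alphabet (budget t)).length ≤ m * k)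
    (h : ∀ i, i < m → checkSeg alphabet t len seeds p (i * k) k = true) : checkCnt alphabet t len seeds p = true := by
  rw [checkCnt, List.all_eq_true]
  intro x hx
  obtain ⟨j, hj, rfl⟩ := List.getElem_of_mem hx
  have hk : 0 < k := by
    rcases Nat.eq_zero_or_pos k with h0 | h0
    · rw [h0, Nat.mul_zero] at hlen; omega
    · exact h0
  have hi : j / k < m := by
    rw [Nat.div_lt_iff_lt_mul hk]; omega
  have hseg := h (j / k) hi
  rw [checkSeg, List.all_eq_true] at hseg
  apply hseg
  rw [List.mem_take_iff_getElem]
  refine ⟨j % k, ?_, ?_⟩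
  · rw [List.length_drop]
    have := Nat.mod_lt j hk
    have : j / k * k + j % k = j := Nat.div_add_mod' j k
    omega
  · rw [List.getElem_drop]
    congr 1
    exact (Nat.div_add_mod' j k)

/-- Fiberwise count of an incidence bit: `Σ_τ #{x : typeCode x = τ} · bit_i(τ) = #{x : bit_i(typeCode x)}` over an alphabet
containing every occurring type. -/
theorem sum_card_fiber_mul_bitN {n : ℕ} (A C : Fin 3 → Finset (Fin n)) (alphabet : List (Fin 64)) (hnd : alphabet.Nodup)
    (hall : ∀ x, typeCode A C x ∈ alphabet) (i : Fin 6) :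
    (alphabet.map fun τ => (Finset.univ.filter fun x => typeCode A C x = τ).card * bitN τ i).sum
      = (Finset.univ.filter fun x : Fin n => (typeCode A C x).val.testBit i.val).card := by
  classical
  rw [← List.sum_toFinset _ hnd]
  rw [Finset.card_eq_sum_card_fiberwise (f := typeCode A C) (s := Finset.univ.filter fun x : Fin n => (typeCode A C x).val.testBit i.val)
    (t := alphabet.toFinset) (fun x _ => List.mem_toFinset.mpr (hall x))]
  refine Finset.sum_congr rfl fun τ _ => ?_
  by_cases hb : τ.val.testBit i.val
  · rw [bitN, if_pos hb, mul_one]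
    congr 1; ext x
    simp only [Finset.mem_filter, Finset.mem_univ, true_and]
    constructor
    · intro hx; exact ⟨by rw [hx]; exact hb, hx⟩
    · intro hx; exact hx.2
  · rw [bitN, if_neg hb, mul_zero]
    symm
    rw [Finset.card_eq_zero, Finset.filter_eq_empty_iff]
    intro x hx hxt
    rw [Finset.mem_filter] at hx
    rw [hxt] at hx
    exact hb hx.2

/-- ★ **THE TRANSFER THEOREM**: a passed `checkCnt alphabet t len seeds p` serves EVERY down-closed 3-swap family of level `t` on
`Fin len` whose coordinate types lie in `alphabet` (standard form at the support). -/
theorem exists_table_of_checkCnt (alphabet : List (Fin 64)) (hnd : alphabet.Nodup) (hpos : ∀ τ ∈ alphabet, 0 < bitSum τ)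
    (t len : ℕ) (seeds : List ℕ) {p : ℕ} (hp : p.Prime) (hB : 2 ^ len * (p * p) < packBase)
    (hchk : checkCnt alphabet t len seeds p = true)
    (A C : Fin 3 → Finset (Fin len)) (hall : ∀ x, typeCode A C x ∈ alphabet)
    (hA : ∀ l, (A l).card = t) (hC : ∀ l, (C l).card = t + 1)
    (hAi : Function.Injective A) (hCi : Function.Injective C) (hAC : ∀ l l', ¬ A l ⊆ C l')
    {r : ℕ} (u cols : Fin r → Finset (Fin len)) (hu : Function.Injective u)
    (hU : ∀ i, ((u i).card ≤ t ∧ ∀ l, u i ≠ A l) ∨ ∃ l, u i = C l)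
    (hcols : ∀ J : Finset (Fin len), J.card ≤ t → ∃ k, cols k = J) :
    ∃ tx : Option (Fin len) → Fin len → ℂ,
      (Matrix.of fun i k : Fin r => ∏ a ∈ u i, (tx none a + ∑ q ∈ cols k, tx (some q) a)).det ≠ 0 := by
  classical
  -- the count vector of the family and its multiplicity list
  set cnt : Fin 64 → ℕ := fun τ => (Finset.univ.filter fun x => typeCode A C x = τ).card with hcnt
  set ks := alphabet.map cnt with hks
  -- total multiplicity = len
  have hsum : (alphabet.map cnt).sum = len := by
    rw [← List.sum_toFinset _ hnd]
    have := (Finset.card_eq_sum_card_fiberwise (f := typeCode A C) (s := (Finset.univ : Finset (Fin len))) (t := alphabet.toFinset)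
      (fun x _ => List.mem_toFinset.mpr (hall x))).symm
    rw [Finset.card_univ, Fintype.card_fin] at this
    exact this
  -- incidence budgets
  have hR : ∀ i : Fin 6, (alphabet.map fun τ => cnt τ * bitN τ i).sum = budget t i := by
    intro i
    rw [budget, sum_card_fiber_mul_bitN A C alphabet hnd hall i]
    by_cases hi : i.val < 3
    · rw [if_pos hi]
      have e : (Finset.univ.filter fun x : Fin len => (typeCode A C x).val.testBit i.val) = A ⟨i.val, hi⟩ := by
        ext x
        have := testBit_typeCode_A A C x ⟨i.val, hi⟩
        simp only [Finset.mem_filter, Finset.mem_univ, true_and]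
        rw [this, decide_eq_true_eq]
      rw [e, hA]
    · rw [if_neg hi]
      have hi' : i.val - 3 < 3 := by omega
      have e : (Finset.univ.filter fun x : Fin len => (typeCode A C x).val.testBit i.val) = C ⟨i.val - 3, hi'⟩ := by
        ext x
        have := testBit_typeCode_C A C x ⟨i.val - 3, hi'⟩
        have e3 : 3 + (i.val - 3) = i.val := by omega
        rw [e3] at this
        simp only [Finset.mem_filter, Finset.mem_univ, true_and]
        rw [this, decide_eq_true_eq]
      rw [e, hC]
  have hR' : ∀ i : Fin 6, ((alphabet.zip ks).map fun τk => τk.2 * bitN τk.1 i).sum = budget t i := by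
    intro i
    rw [← hR i, hks, sum_zip_map_self]
  -- the run-length list is enumerated, so the check covers it
  set L := rlList alphabet ks with hL
  have hmem : L ∈ enumSeq alphabet (budget t) := rlList_mem_enumSeq alphabet hpos ks (by rw [hks, List.length_map]) _ hR'
  have hentry := List.all_eq_true.mp hchk L hmem
  have hLlen : L.length = len := by rw [hL, hks, length_rlList_map, hsum]
  -- the rebuilt family is a relabelling of `(A, C)`
  have hfib : ∀ τ, (Finset.univ.filter fun x => typeCode A C x = τ).card
      = (Finset.univ.filter fun i => (rlFun L ∘ Fin.cast hLlen.symm) i = τ).card := by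
    intro τ
    have h1 : (Finset.univ.filter fun i : Fin len => (rlFun L ∘ Fin.cast hLlen.symm) i = τ).card
        = (Finset.univ.filter fun i : Fin L.length => rlFun L i = τ).card := by
      refine Finset.card_bij (fun i _ => Fin.cast hLlen.symm i) (fun i hi => by simpa using hi)
        (fun i _ j _ hij => by simpa [Fin.ext_iff] using hij) (fun j hj => ⟨Fin.cast hLlen j, by simpa using hj, by simp⟩)
    rw [h1, card_fiber_rlFun, hL, hks, count_rlList_map alphabet hnd cnt τ]
    by_cases hτ : τ ∈ alphabet
    · rw [if_pos hτ]
    · rw [if_neg hτ, Finset.card_eq_zero, Finset.filter_eq_empty_iff]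
      intro x _ hx; exact hτ (hx ▸ hall x)
  obtain ⟨σ, hσ⟩ := exists_perm_comp_eq (typeCode A C) (rlFun L ∘ Fin.cast hLlen.symm) hfib
  -- `rlFun L = (typeCode A C ∘ σ) ∘ e` with `e : Fin L.length ≃ Fin len` the cast
  set e : Fin L.length ≃ Fin len := finCongr hLlen with he
  have hg : rlFun L = (typeCode A C ∘ σ) ∘ e := by
    funext j
    have := hσ (e j)
    simp only [Function.comp] at this ⊢
    rw [this, he, finCongr_apply]
    congr 1
  set ι : Fin L.length ↪ Fin len := e.toEmbedding.trans σ.toEmbedding with hι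
  have hmapA : ∀ l, (famA (rlFun L) l).map ι = A l := fun l => by
    rw [hι, ← Finset.map_map, hg, map_famA_equiv, map_famA_comp]
  have hmapC : ∀ l, (famC (rlFun L) l).map ι = C l := fun l => by
    rw [hι, ← Finset.map_map, hg, map_famC_equiv, map_famC_comp]
  -- shape of the rebuilt family (transported from `(A, C)` through `ι`)
  have hA' : ∀ l, (famA (rlFun L) l).card = t := fun l => by rw [← Finset.card_map ι, hmapA, hA]
  have hC' : ∀ l, (famC (rlFun L) l).card = t + 1 := fun l => by rw [← Finset.card_map ι, hmapC, hC]
  have hAi' : Function.Injective (famA (rlFun L)) := fun l l' hll' =>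
    hAi (by rw [← hmapA l, ← hmapA l', hll'])
  have hCi' : Function.Injective (famC (rlFun L)) := fun l l' hll' =>
    hCi (by rw [← hmapC l, ← hmapC l', hll'])
  have hAC' : ∀ l l', ¬ famA (rlFun L) l ⊆ famC (rlFun L) l' := fun l l' hsub =>
    hAC l l' (by rw [← hmapA l, ← hmapC l']; exact Finset.map_subset_map.mpr hsub)
  -- the check entry: hypotheses hold, so the certificate passed at some seed
  have hshape : (decide (L.length = len) && shapeOK L.length t (famA (rlFun L)) (famC (rlFun L)) &&
      decide (∀ l l', ¬ famA (rlFun L) l ⊆ famC (rlFun L) l')) = true := by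
    rw [Bool.and_eq_true, Bool.and_eq_true, shapeOK, decide_eq_true_eq, decide_eq_true_eq, decide_eq_true_eq]
    exact ⟨⟨hLlen, hA', hC', hAi', hCi'⟩, hAC'⟩
  simp only [checkEntry] at hentry
  rw [hshape] at hentry
  simp only [Bool.not_true, Bool.false_or, List.any_eq_true] at hentry
  obtain ⟨s, -, hs⟩ := hentry
  have hB' : 2 ^ L.length * (p * p) < packBase := by rw [hLlen]; exact hB
  -- serve `(A, C)` = the image of the rebuilt family under `ι`
  exact exists_table_of_certCheckN_map L.length t ι _ _ hA' hC' hAi' hCi' _ hp hB' hs u cols hu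
    (fun i => by simpa only [hmapA, hmapC] using hU i) hcols

/-! ## 5b. All lengths at once -/

/-- **The classification check for ALL supports at level `t`** (one enumeration): every enumerated type list passes `checkEntry` at
its own length. -/
def checkAll (alphabet : List (Fin 64)) (t : ℕ) (seeds : List ℕ) (p : ℕ) : Bool :=
  (enumSeq alphabet (budget t)).all fun L => checkEntry t L.length seeds p L

/-- A SEGMENT of `checkAll` (entries `a, …, a + k - 1`). -/
def checkAllSeg (alphabet : List (Fin 64)) (t : ℕ) (seeds : List ℕ) (p : ℕ) (a k : ℕ) : Bool :=
  (((enumSeq alphabet (budget t)).drop a).take k).all fun L => checkEntry t L.length seeds p L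

/-- Segments of length `k` at `0, k, …, (m-1)k` covering the enumeration give `checkAll`. -/
theorem checkAll_of_seg (alphabet : List (Fin 64)) (t : ℕ) (seeds : List ℕ) (p : ℕ) (k m : ℕ)
    (hlen : (enumSeq alphabet (budget t)).length ≤ m * k)
    (h : ∀ i, i < m → checkAllSeg alphabet t seeds p (i * k) k = true) : checkAll alphabet t seeds p = true := by
  rw [checkAll, List.all_eq_true]
  intro x hx
  obtain ⟨j, hj, rfl⟩ := List.getElem_of_mem hx
  have hk : 0 < k := by
    rcases Nat.eq_zero_or_pos k with h0 | h0
    · rw [h0, Nat.mul_zero] at hlen; omega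
    · exact h0
  have hi : j / k < m := by
    rw [Nat.div_lt_iff_lt_mul hk]; omega
  have hseg := h (j / k) hi
  rw [checkAllSeg, List.all_eq_true] at hseg
  apply hseg
  rw [List.mem_take_iff_getElem]
  refine ⟨j % k, ?_, ?_⟩
  · rw [List.length_drop]
    have := Nat.mod_lt j hk
    have : j / k * k + j % k = j := Nat.div_add_mod' j k
    omega
  · rw [List.getElem_drop]
    congr 1
    exact (Nat.div_add_mod' j k)

/-- `checkAll` gives `checkCnt` at every length (entries of other lengths pass `checkEntry t len` trivially). -/
theorem checkCnt_of_checkAll (alphabet : List (Fin 64)) (t : ℕ) (seeds : List ℕ) (p : ℕ) (hall : checkAll alphabet t seeds p = true)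
    (len : ℕ) : checkCnt alphabet t len seeds p = true := by
  rw [checkCnt, List.all_eq_true]
  rw [checkAll, List.all_eq_true] at hall
  intro L hL
  have h := hall L hL
  by_cases hlen : L.length = len
  · rw [← hlen]; exact h
  · simp only [checkEntry, hlen, decide_false, Bool.false_and, Bool.not_false, Bool.true_or]

/-! ## 6. The alphabet of unbalanced types -/

/-- The 44 UNBALANCED types: `#{l : bit l} ≠ #{l : bit (3+l)}` (in particular not the free type). -/
def unbalancedTypes : List (Fin 64) :=
  (List.finRange 64).filter fun τ => (bitN τ 0 + bitN τ 1 + bitN τ 2) ≠ (bitN τ 3 + bitN τ 4 + bitN τ 5)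

/-- The alphabet has no duplicates. -/
theorem nodup_unbalancedTypes : unbalancedTypes.Nodup := (List.nodup_finRange 64).filter _

/-- Every unbalanced type has at least one bit. -/
theorem bitSum_pos_of_mem_unbalancedTypes : ∀ τ ∈ unbalancedTypes, 0 < bitSum τ := by
  decide

/-- A totally unbalanced family has all its types in the alphabet. -/
theorem typeCode_mem_unbalancedTypes {n : ℕ} (A C : Fin 3 → Finset (Fin n))
    (htu : ∀ x : Fin n, (Finset.univ.filter fun l => x ∈ A l).card ≠ (Finset.univ.filter fun l => x ∈ C l).card) (x : Fin n) :
    typeCode A C x ∈ unbalancedTypes := by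
  rw [unbalancedTypes, List.mem_filter]
  refine ⟨List.mem_finRange _, ?_⟩
  rw [decide_eq_true_eq]
  have hAcard : (Finset.univ.filter fun l => x ∈ A l).card = bitN (typeCode A C x) 0 + bitN (typeCode A C x) 1 + bitN (typeCode A C x) 2 := by
    have e : ∀ l : Fin 3, bitN (typeCode A C x) ⟨l.val, by omega⟩ = if x ∈ A l then 1 else 0 := fun l => by
      rw [bitN]; simp only; rw [testBit_typeCode_A]; by_cases h : x ∈ A l <;> simp [h]
    rw [Finset.card_filter, Fin.sum_univ_three]
    have e0 := e 0; have e1 := e 1; have e2 := e 2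
    simp only [Fin.val_zero, Fin.val_one, Fin.val_two] at e0 e1 e2
    rw [show (0 : Fin 6) = ⟨0, by omega⟩ from rfl, show (1 : Fin 6) = ⟨1, by omega⟩ from rfl, show (2 : Fin 6) = ⟨2, by omega⟩ from rfl,
      e0, e1, e2]
  have hCcard : (Finset.univ.filter fun l => x ∈ C l).card = bitN (typeCode A C x) 3 + bitN (typeCode A C x) 4 + bitN (typeCode A C x) 5 := by
    have e : ∀ l : Fin 3, bitN (typeCode A C x) ⟨3 + l.val, by omega⟩ = if x ∈ C l then 1 else 0 := fun l => by
      rw [bitN]; simp only; rw [testBit_typeCode_C]; by_cases h : x ∈ C l <;> simp [h]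
    rw [Finset.card_filter, Fin.sum_univ_three]
    have e0 := e 0; have e1 := e 1; have e2 := e 2
    simp only [Fin.val_zero, Fin.val_one, Fin.val_two] at e0 e1 e2
    rw [show (3 : Fin 6) = ⟨3, by omega⟩ from rfl, show (4 : Fin 6) = ⟨4, by omega⟩ from rfl, show (5 : Fin 6) = ⟨5, by omega⟩ from rfl,
      e0, e1, e2]
  rw [← hAcard, ← hCcard]
  exact htu x

/-- A family whose types all have at least one bit set has at most `Σ_l |A_l| + Σ_l |C_l|` coordinates. -/
theorem le_of_typeCode_mem_unbalancedTypes {n : ℕ} (A C : Fin 3 → Finset (Fin n))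
    (hall : ∀ x, typeCode A C x ∈ unbalancedTypes) :
    n ≤ ∑ l : Fin 3, (A l).card + ∑ l : Fin 3, (C l).card := by
  classical
  -- every coordinate lies in some `A_l` or `C_l`
  have hcov : ∀ x : Fin n, ∃ l, x ∈ A l ∨ x ∈ C l := by
    intro x
    have hx := hall x
    rw [unbalancedTypes, List.mem_filter, decide_eq_true_eq] at hx
    by_contra hno
    push Not at hno
    have hz : ∀ i : Fin 6, bitN (typeCode A C x) i = 0 := by
      intro i
      rw [bitN]
      by_cases hi : i.val < 3
      · have := testBit_typeCode_A A C x ⟨i.val, hi⟩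
        simp only at this
        rw [this]; simp [(hno ⟨i.val, hi⟩).1]
      · have hi' : i.val - 3 < 3 := by omega
        have := testBit_typeCode_C A C x ⟨i.val - 3, hi'⟩
        rw [show 3 + (i.val - 3) = i.val by omega] at this
        rw [this]; simp [(hno ⟨i.val - 3, hi'⟩).2]
    exact hx.2 (by rw [hz, hz, hz, hz, hz, hz])
  -- count: `univ ⊆ ⋃ A_l ∪ ⋃ C_l`
  have hsub : (Finset.univ : Finset (Fin n)) ⊆ (Finset.univ.biUnion A) ∪ (Finset.univ.biUnion C) := by
    intro x _
    obtain ⟨l, hl | hl⟩ := hcov x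
    · exact Finset.mem_union_left _ (Finset.mem_biUnion.mpr ⟨l, Finset.mem_univ _, hl⟩)
    · exact Finset.mem_union_right _ (Finset.mem_biUnion.mpr ⟨l, Finset.mem_univ _, hl⟩)
  calc n = (Finset.univ : Finset (Fin n)).card := by simp
    _ ≤ ((Finset.univ.biUnion A) ∪ (Finset.univ.biUnion C)).card := Finset.card_le_card hsub
    _ ≤ (Finset.univ.biUnion A).card + (Finset.univ.biUnion C).card := Finset.card_union_le _ _
    _ ≤ ∑ l, (A l).card + ∑ l, (C l).card := Nat.add_le_add Finset.card_biUnion_le Finset.card_biUnion_le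

end BallCut

end Summit.ValiantsHypothesis.ValiantsHypothesis.Theorems.BarrierLever.HiddenStates
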